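import Summits.Ventures.DiscreteObjects.Hadamard.CyclicCorePAF
import Summits.Ventures.DiscreteObjects.Hadamard.Order25TimesPrime668
import Summits.Ventures.DiscreteObjects.Hadamard.PlugIns668
import Summits.Ventures.DiscreteObjects.Hadamard.CompositeOrder23

/-!
# H(668): an automorphism of order 333 is EXACTLY a Legendre pair of length 333 (kernel) — the order-333 census line is
# PLAN-H's family F3 (two circulant cores)

Framing: lottery ticket; floor = certified bounds/negative ranges.

Cell pub-namedobj (venture DiscreteObjects), target (H), hadamard gen 19.  HANDOFF-H-g18 item 3 recorded that the cyclic
orbit-type enumeration leaves ONE type for an element of order `333 = 9·37` of the signed automorphism group of a putative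
H(668) and asked whether 'a Gram/orbit-matrix argument on 2 + 2 orbit rows might kill it'.  Answer: it cannot, because that type
is precisely a Legendre pair of length `333`, the open object of PLAN-H's family F3 [Fletcher–Gysin–Seberry 2001;
arXiv:2607.20765 (2026)]:
* **`hadamard668_order333_orbitType`** (kernel orbit type): for a signed automorphism `(π, κ, d, e)` of an H(668) with
  `π^333 = κ^333 = 1`, `(π^111, κ^111) ≠ (1,1)`, `(π^9, κ^9) ≠ (1,1)` (pair order exactly `333`), `κ` fixes EXACTLY `2` columns
  and every other column is free of period `333` (two regular orbits); rows alike.  [Order 111 (`hadamard668_order111_structure`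
  on `(π³, κ³)`): `Fix κ^111 = Fix κ^111 ∩ Fix κ^9`, `2` points; order 37 (`hadamard668_fixedRows_37` on `(π⁹, κ⁹)`): `#Fix κ^9 = 2`;
  so `Fix κ^9 = Fix κ^111 =: F`; `κ` permutes the 2-set `F` with `κ^333 = 1`, hence fixes it pointwise; a moved column with a
  period `d < 333`, `d ∣ 333`, would lie in `Fix κ^9 ∪ Fix κ^111 = F = Fix κ`.]
* **`legendrePair_of_hadamard668_signedAut_333`**: such an automorphism yields `a b : ZMod 333 → ℤ` with `LegendrePair a b`
  (`±1`, `PAF_a(s) + PAF_b(s) = −2` for `s ≠ 0`) — the cyclic-core identity `CyclicCorePAF.exists_paf_family_signed` with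
  `#Fix κ = 2` and a transversal of size `(668 − 2)/333 = 2`; `legendrePair_of_hadamard668_orderOf_dvd_333` is the
  `333 ∣ orderOf (π, κ)` form.
* **`hadamard668_aut333_of_legendrePair`** (converse, by construction): a Legendre pair of length `333` gives the
  two-circulant-core Hadamard matrix of order `668` on `CoreIdx 333` [FGS 2001 plug-in, `twoCircCore`], and the simultaneous
  cyclic shift of both cores is a permutation automorphism of pair order exactly `333`.
* **`hadamard668_aut333_iff_legendrePair333`**: *some Hadamard matrix of order 668 has a signed automorphism whose permutation
  pair has order divisible by 333 ↔ a Legendre pair of length 333 exists.*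
So the surviving order-333 line of the census is not a counting problem but the LP(333) existence problem itself; every kernel
exclusion of LP(333) sub-families in the tree (`Literature.….LegendrePairs.*333*`, `NonCyclicLP333*`) is a statement about
automorphisms of order 333 of a putative H(668), and conversely.  Dictionary / structure; no order excluded; H(668) untouched.
The array ⇔ pair equivalence is Fletcher–Gysin–Seberry 2001 (replication side); the orbit-type forcing at 668 and the kernel
statements are ours; no `sorry`.
-/

namespace Summit.Ventures.DiscreteObjects.Hadamard

open Finset BigOperators Matrix

open Literature.Combinatorics.Designs.GoethalsSeidel (IsHadamardMatrix)
open Literature.Combinatorics.Designs.LegendrePairs (PAF IsPM LegendrePair CoreIdx twoCircCore twoCircCore_pm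
  twoCircCore_mul_transpose rowsum_sq pm_of_sq card_coreIdx)

variable {ι : Type*} [Fintype ι] [DecidableEq ι]

/-! ### the orbit type of an element of order 333 -/

/-- proper divisors of `333` divide `9` or `111` -/
lemma dvd_9_or_111_of_dvd_333 : ∀ d ∈ Nat.divisors 333, d < 333 → d ∣ 9 ∨ d ∣ 111 := by decide

omit [Fintype ι] [DecidableEq ι] in
/-- a point of period `2` and period `333` under a permutation is fixed -/
lemma fixed_of_sq_of_pow333 (κ : Equiv.Perm ι) {y : ι} (h2 : κ (κ y) = y) (h333 : (κ ^ 333) y = y) : κ y = y := by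
  have e : (κ ^ 333) y = κ y := by
    have h2' : (κ ^ 2) y = y := by rw [pow_two, Equiv.Perm.mul_apply, h2]
    rw [show (333 : ℕ) = 1 + 2 * 166 by norm_num, pow_add, pow_one, Equiv.Perm.mul_apply, pow_mul,
      perm_pow_apply_of_fixed (κ ^ 2) h2' 166]
  rw [← e, h333]

/-- columns, order 333: exactly `2` fixed columns, all other columns free of period `333` -/
lemma order333_cols {H : Matrix ι ι ℤ} (hH : IsHadamardMatrix H) (hι : Fintype.card ι = 668)
    {π κ : Equiv.Perm ι} {d e : ι → ℤ} (haut : IsSignedAut H π κ d e)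
    (hπ : π ^ 333 = 1) (hκ : κ ^ 333 = 1) (h111 : π ^ 111 ≠ 1 ∨ κ ^ 111 ≠ 1) (h9 : π ^ 9 ≠ 1 ∨ κ ^ 9 ≠ 1) :
    (univ.filter fun y => κ y = y).card = 2 ∧ ∀ y, κ y ≠ y → ∀ k, 0 < k → k < 333 → (κ ^ k) y ≠ y := by
  -- order 111 on (π³, κ³)
  have h3π : (π ^ 3) ^ (3 * 37) = 1 := by rw [← pow_mul]; exact hπ
  have h3κ : (κ ^ 3) ^ (3 * 37) = 1 := by rw [← pow_mul]; exact hκ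
  have h37' : (π ^ 3) ^ 37 ≠ 1 ∨ (κ ^ 3) ^ 37 ≠ 1 := by rw [← pow_mul, ← pow_mul]; exact h111
  have h3' : (π ^ 3) ^ 3 ≠ 1 ∨ (κ ^ 3) ^ 3 ≠ 1 := by rw [← pow_mul, ← pow_mul]; exact h9
  obtain ⟨-, hc111, -, hcint⟩ := hadamard668_order111_structure hH hι (π ^ 3) (κ ^ 3) _ _ (isSignedAut_pow haut 3)
    h3π h3κ h37' h3'
  simp only [← pow_mul] at hc111 hcint
  norm_num at hc111 hcint
  -- order 37 on (π⁹, κ⁹)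
  have h9π : (π ^ 9) ^ 37 = 1 := by rw [← pow_mul]; exact hπ
  have h9κ : (κ ^ 9) ^ 37 = 1 := by rw [← pow_mul]; exact hκ
  obtain ⟨-, hc9⟩ := hadamard668_fixedRows_37 hH hι (π ^ 9) (κ ^ 9) _ _ (isSignedAut_pow haut 9) h9π h9κ h9
  -- Fix κ^9 = Fix κ^111 ∩ Fix κ^9 = Fix κ^111
  have hsub1 : (univ.filter fun y => (κ ^ 111) y = y ∧ (κ ^ 9) y = y) ⊆ univ.filter fun y => (κ ^ 9) y = y := by
    intro y hy
    rw [Finset.mem_filter] at hy ⊢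
    exact ⟨hy.1, hy.2.2⟩
  have hsub2 : (univ.filter fun y => (κ ^ 111) y = y ∧ (κ ^ 9) y = y) ⊆ univ.filter fun y => (κ ^ 111) y = y := by
    intro y hy
    rw [Finset.mem_filter] at hy ⊢
    exact ⟨hy.1, hy.2.1⟩
  have heq1 := Finset.eq_of_subset_of_card_le hsub1 (by rw [hc9, hcint])
  have heq2 := Finset.eq_of_subset_of_card_le hsub2 (by rw [hc111, hcint])
  have h9_111 : ∀ y, (κ ^ 9) y = y → (κ ^ 111) y = y := by
    intro y hy
    have hm : y ∈ univ.filter fun y => (κ ^ 9) y = y := Finset.mem_filter.mpr ⟨Finset.mem_univ _, hy⟩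
    rw [← heq1, Finset.mem_filter] at hm
    exact hm.2.1
  have h111_9 : ∀ y, (κ ^ 111) y = y → (κ ^ 9) y = y := by
    intro y hy
    have hm : y ∈ univ.filter fun y => (κ ^ 111) y = y := Finset.mem_filter.mpr ⟨Finset.mem_univ _, hy⟩
    rw [← heq2, Finset.mem_filter] at hm
    exact hm.2.2
  -- κ fixes Fix κ^9 pointwise
  have hstab : ∀ y, (κ ^ 9) y = y → (κ ^ 9) (κ y) = κ y := by
    intro y hy
    rw [← Equiv.Perm.mul_apply, ← pow_succ, pow_succ', Equiv.Perm.mul_apply, hy]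
  have hfix9 : ∀ y, (κ ^ 9) y = y → κ y = y := by
    intro y hy
    by_contra hne
    have hy1 := hstab y hy
    have hy2 := hstab _ hy1
    have h333y : (κ ^ 333) y = y := by rw [hκ, Equiv.Perm.one_apply]
    -- three points y, κ y, κ (κ y) in a 2-set
    by_cases h2 : κ (κ y) = y
    · exact hne (fixed_of_sq_of_pow333 κ h2 h333y)
    · have hne' : κ (κ y) ≠ κ y := fun h => hne (κ.injective h)
      have hsub : ({y, κ y, κ (κ y)} : Finset ι) ⊆ univ.filter fun y => (κ ^ 9) y = y := by
        intro z hz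
        simp only [Finset.mem_insert, Finset.mem_singleton] at hz
        rw [Finset.mem_filter]
        rcases hz with rfl | rfl | rfl
        · exact ⟨Finset.mem_univ _, hy⟩
        · exact ⟨Finset.mem_univ _, hy1⟩
        · exact ⟨Finset.mem_univ _, hy2⟩
      have hcard3 : ({y, κ y, κ (κ y)} : Finset ι).card = 3 := by
        rw [Finset.card_insert_of_notMem, Finset.card_insert_of_notMem, Finset.card_singleton]
        · simpa using hne'.symm
        · simp only [Finset.mem_insert, Finset.mem_singleton, not_or]
          exact ⟨fun h => hne h.symm, fun h => h2 h.symm⟩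
      have := Finset.card_le_card hsub
      rw [hcard3, hc9] at this
      omega
  -- conclusion 1: Fix κ = Fix κ^9
  have hFix : (univ.filter fun y => κ y = y) = univ.filter fun y => (κ ^ 9) y = y := by
    ext y
    simp only [Finset.mem_filter, Finset.mem_univ, true_and]
    exact ⟨fun h => perm_pow_apply_of_fixed κ h 9, hfix9 y⟩
  refine ⟨by rw [hFix, hc9], fun y hy => ?_⟩
  -- conclusion 2: freeness
  refine free_of_proper_divisors κ (by rw [hκ, Equiv.Perm.one_apply]) fun dd hdd hlt hfix => hy ?_
  have hmem : dd ∈ Nat.divisors 333 := Nat.mem_divisors.mpr ⟨hdd, by norm_num⟩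
  rcases dvd_9_or_111_of_dvd_333 dd hmem hlt with ⟨m, hm⟩ | ⟨m, hm⟩
  · apply hfix9
    rw [hm, pow_mul]
    exact perm_pow_apply_of_fixed _ hfix m
  · apply hfix9; apply h111_9
    rw [hm, pow_mul]
    exact perm_pow_apply_of_fixed _ hfix m

/-- **Order 333: the orbit type.**  A signed automorphism `(π, κ, d, e)` of a Hadamard matrix of order `668` whose permutation
pair has order exactly `333` (`π^333 = κ^333 = 1`, `(π^111, κ^111) ≠ (1,1)`, `(π^9, κ^9) ≠ (1,1)`) fixes exactly `2` rows and
`2` columns, and every other row / column is free of period `333` (two regular `⟨(π, κ)⟩`-orbits of length `333` on each side). -/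
theorem hadamard668_order333_orbitType {H : Matrix ι ι ℤ} (hH : IsHadamardMatrix H) (hι : Fintype.card ι = 668)
    (π κ : Equiv.Perm ι) (d e : ι → ℤ) (haut : IsSignedAut H π κ d e)
    (hπ : π ^ 333 = 1) (hκ : κ ^ 333 = 1) (h111 : π ^ 111 ≠ 1 ∨ κ ^ 111 ≠ 1) (h9 : π ^ 9 ≠ 1 ∨ κ ^ 9 ≠ 1) :
    ((univ.filter fun x => π x = x).card = 2 ∧ ∀ x, π x ≠ x → ∀ k, 0 < k → k < 333 → (π ^ k) x ≠ x) ∧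
    ((univ.filter fun y => κ y = y).card = 2 ∧ ∀ y, κ y ≠ y → ∀ k, 0 < k → k < 333 → (κ ^ k) y ≠ y) := by
  have hcard : (Fintype.card ι : ℤ) ≠ 0 := by rw [hι]; norm_num
  exact ⟨order333_cols (isHadamard_transpose hH hcard) hι (isSignedAut_transpose haut) hκ hπ h111.symm h9.symm,
    order333_cols hH hι haut hπ hκ h111 h9⟩

/-! ### order 333 ⇒ a Legendre pair of length 333 -/

/-- **Order 333 ⇒ LP(333).**  A signed automorphism of a Hadamard matrix of order `668` whose permutation pair has order exactly
`333` yields a Legendre pair of length `333`: `±1` sequences `a, b` on `ZMod 333` with `PAF_a(s) + PAF_b(s) = −2` for all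
`s ≠ 0`. -/
theorem legendrePair_of_hadamard668_signedAut_333 {H : Matrix ι ι ℤ} (hH : IsHadamardMatrix H)
    (hι : Fintype.card ι = 668) {π κ : Equiv.Perm ι} {d e : ι → ℤ} (haut : IsSignedAut H π κ d e)
    (hπ : π ^ 333 = 1) (hκ : κ ^ 333 = 1) (h111 : π ^ 111 ≠ 1 ∨ κ ^ 111 ≠ 1) (h9 : π ^ 9 ≠ 1 ∨ κ ^ 9 ≠ 1) :
    ∃ a b : ZMod 333 → ℤ, LegendrePair a b := by
  obtain ⟨⟨hrow, hrowfree⟩, hcol, hcolfree⟩ := hadamard668_order333_orbitType hH hι π κ d e haut hπ hκ h111 h9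
  -- a moved row exists
  have hmovedR : (univ.filter fun x => π x ≠ x).card = 666 := by
    have := Finset.card_filter_add_card_filter_not (s := (univ : Finset ι)) (fun x => π x = x)
    rw [hrow, Finset.card_univ, hι] at this
    have h' : (univ.filter fun x => ¬ π x = x).card = 666 := by omega
    exact h'
  obtain ⟨x₀, hx₀m⟩ : ∃ x₀, x₀ ∈ univ.filter fun x => π x ≠ x :=
    Finset.card_pos.mp (by rw [hmovedR]; norm_num)
  have hx₀ := hrowfree x₀ (Finset.mem_filter.mp hx₀m).2
  obtain ⟨T, hTcard, a, ha, hpaf⟩ := exists_paf_family_signed hH haut (by decide : Odd 333) hπ hκ hcolfree hx₀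
  have hmovedC : (univ.filter fun y => κ y ≠ y).card = 666 := by
    have := Finset.card_filter_add_card_filter_not (s := (univ : Finset ι)) (fun y => κ y = y)
    rw [hcol, Finset.card_univ, hι] at this
    have h' : (univ.filter fun y => ¬ κ y = y).card = 666 := by omega
    exact h'
  rw [hmovedC] at hTcard
  have hT2 : T.card = 2 := by omega
  rw [hcol] at hpaf
  let eq2 : {y // y ∈ T} ≃ Fin 2 := Finset.equivFinOfCardEq hT2
  refine ⟨a (eq2.symm 0), a (eq2.symm 1), ha _, ha _, fun s hs => ?_⟩
  have h := hpaf s hs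
  have hre : ∑ i : Fin 2, PAF (a (eq2.symm i)) s = ∑ y, PAF (a y) s :=
    Fintype.sum_equiv eq2.symm _ _ (fun _ => rfl)
  rw [← hre, Fin.sum_univ_two] at h
  simpa using h

/-- **Order form.**  If `333` divides the order of the permutation pair of a signed automorphism of a Hadamard matrix of order
`668`, a Legendre pair of length `333` exists. -/
theorem legendrePair_of_hadamard668_orderOf_dvd_333 {H : Matrix ι ι ℤ} (hH : IsHadamardMatrix H)
    (hι : Fintype.card ι = 668) {π κ : Equiv.Perm ι} {d e : ι → ℤ} (haut : IsSignedAut H π κ d e)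
    (hdvd : 333 ∣ orderOf ((π, κ) : Equiv.Perm ι × Equiv.Perm ι)) :
    ∃ a b : ZMod 333 → ℤ, LegendrePair a b := by
  set x : Equiv.Perm ι × Equiv.Perm ι := (π, κ) with hx
  have hx0 : orderOf x ≠ 0 := (orderOf_pos x).ne'
  set k := orderOf x / 333 with hk
  have hord : orderOf (x ^ k) = 333 := orderOf_pow_orderOf_div hx0 hdvd
  have hxk : x ^ k = ((π ^ k, κ ^ k) : Equiv.Perm ι × Equiv.Perm ι) := by rw [hx, Prod.pow_mk]
  rw [hxk] at hord
  obtain ⟨h1, h2, h3⟩ := pow_data_of_orderOf hord (a := 111) (by norm_num) (by norm_num)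
  obtain ⟨-, -, h4⟩ := pow_data_of_orderOf hord (a := 9) (by norm_num) (by norm_num)
  exact legendrePair_of_hadamard668_signedAut_333 hH hι (isSignedAut_pow haut k) h1 h2 h3 h4

/-! ### the converse: the two-circulant-core matrix of a Legendre pair carries the shift of order 333 -/

section converse
variable {n : ℕ} [NeZero n]

omit [NeZero n] in
/-- powers of the simultaneous cyclic shift of both cores (border fixed) on the four kinds of indices; the shift is written
out as a term (no definition): `Equiv.sumCongr (refl) (sumCongr (addRight 1) (addRight 1))` -/
lemma coreShift_pow_apply (k : ℕ) :
    (∀ u : Unit ⊕ Unit, ((Equiv.sumCongr (Equiv.refl (Unit ⊕ Unit))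
      (Equiv.sumCongr (Equiv.addRight (1 : ZMod n)) (Equiv.addRight (1 : ZMod n))) : Equiv.Perm (CoreIdx n)) ^ k) (Sum.inl u) = Sum.inl u) ∧
    (∀ i : ZMod n, ((Equiv.sumCongr (Equiv.refl (Unit ⊕ Unit))
      (Equiv.sumCongr (Equiv.addRight (1 : ZMod n)) (Equiv.addRight (1 : ZMod n))) : Equiv.Perm (CoreIdx n)) ^ k) (Sum.inr (Sum.inl i)) = Sum.inr (Sum.inl (i + k))) ∧
    (∀ i : ZMod n, ((Equiv.sumCongr (Equiv.refl (Unit ⊕ Unit))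
      (Equiv.sumCongr (Equiv.addRight (1 : ZMod n)) (Equiv.addRight (1 : ZMod n))) : Equiv.Perm (CoreIdx n)) ^ k) (Sum.inr (Sum.inr i)) = Sum.inr (Sum.inr (i + k))) := by
  induction k with
  | zero => simp
  | succ k ih =>
    obtain ⟨h1, h2, h3⟩ := ih
    refine ⟨fun u => ?_, fun i => ?_, fun i => ?_⟩
    · rw [pow_succ', Equiv.Perm.mul_apply, h1]; rfl
    · rw [pow_succ', Equiv.Perm.mul_apply, h2]
      show Sum.inr (Sum.inl (i + k + 1)) = _
      push_cast; rw [add_assoc]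
    · rw [pow_succ', Equiv.Perm.mul_apply, h3]
      show Sum.inr (Sum.inr (i + k + 1)) = _
      push_cast; rw [add_assoc]

omit [NeZero n] in
/-- the shift is a permutation automorphism of the two-circulant-core matrix -/
lemma twoCircCore_coreShift (a b : ZMod n → ℤ) (x y : CoreIdx n) :
    twoCircCore a b ((Equiv.sumCongr (Equiv.refl (Unit ⊕ Unit))
      (Equiv.sumCongr (Equiv.addRight (1 : ZMod n)) (Equiv.addRight (1 : ZMod n))) : Equiv.Perm (CoreIdx n)) x) ((Equiv.sumCongr (Equiv.refl (Unit ⊕ Unit))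
      (Equiv.sumCongr (Equiv.addRight (1 : ZMod n)) (Equiv.addRight (1 : ZMod n))) : Equiv.Perm (CoreIdx n)) y) = twoCircCore a b x y := by
  rcases x with (u | u) | (i | i) <;> rcases y with (v | v) | (j | j) <;>
    simp [twoCircCore, add_sub_add_right_eq_sub]

/-- negating one sequence preserves the Legendre-pair property -/
private lemma legendrePair_neg_left' (a b : ZMod n → ℤ) (h : LegendrePair a b) : LegendrePair (-a) b := by
  obtain ⟨ha, hb, hL⟩ := h
  refine ⟨fun i => ?_, hb, fun s hs => ?_⟩
  · rcases ha i with h | h <;> simp [h]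
  · rw [← hL s hs]; unfold PAF; simp

/-- … and for the second sequence -/
private lemma legendrePair_neg_right' (a b : ZMod n → ℤ) (h : LegendrePair a b) : LegendrePair a (-b) := by
  obtain ⟨ha, hb, hL⟩ := h
  refine ⟨ha, fun i => ?_, fun s hs => ?_⟩
  · rcases hb i with h | h <;> simp [h]
  · rw [← hL s hs]; unfold PAF; simp

/-- row-sum normalisation of a Legendre pair (both sums `+1`) -/
private lemma legendrePair_normalise (a b : ZMod n → ℤ) (h : LegendrePair a b) :
    ∃ a' b' : ZMod n → ℤ, LegendrePair a' b' ∧ (∑ i, a' i) = 1 ∧ (∑ i, b' i) = 1 := by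
  obtain ⟨a', ha', hab'⟩ : ∃ a' : ZMod n → ℤ, (∑ i, a' i) = 1 ∧ LegendrePair a' b := by
    rcases pm_of_sq _ _ (rowsum_sq a b h) with h1 | h1
    · exact ⟨a, h1, h⟩
    · refine ⟨-a, ?_, legendrePair_neg_left' a b h⟩
      simp only [Pi.neg_apply, Finset.sum_neg_distrib, h1, neg_neg]
  obtain ⟨b', hb', hab⟩ : ∃ b' : ZMod n → ℤ, (∑ i, b' i) = 1 ∧ LegendrePair a' b' := by
    have hsq := rowsum_sq a' b hab'
    rcases pm_of_sq _ _ (by rw [add_comm]; exact hsq) with h1 | h1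
    · exact ⟨b, h1, hab'⟩
    · refine ⟨-b, ?_, legendrePair_neg_right' a' b hab'⟩
      simp only [Pi.neg_apply, Finset.sum_neg_distrib, h1, neg_neg]
  exact ⟨a', b', hab, ha', hb'⟩

end converse

/-- **LP(333) ⇒ an H(668) with an automorphism of order 333** (the two-circulant-core matrix and the simultaneous shift of its
cores): there is a Hadamard matrix `H` of order `668 = |CoreIdx 333|` with a permutation automorphism `σ` (acting on rows and
on columns, signs `+1`) with `σ^333 = 1`, `σ^111 ≠ 1`, `σ^9 ≠ 1`, i.e. `orderOf (σ, σ) = 333`. -/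
theorem hadamard668_aut333_of_legendrePair (a b : ZMod 333 → ℤ) (h : LegendrePair a b) :
    ∃ (H : Matrix (CoreIdx 333) (CoreIdx 333) ℤ) (σ : Equiv.Perm (CoreIdx 333)),
      IsHadamardMatrix H ∧ Fintype.card (CoreIdx 333) = 668 ∧ IsSignedAut H σ σ (fun _ => 1) (fun _ => 1) ∧
      σ ^ 333 = 1 ∧ σ ^ 111 ≠ 1 ∧ σ ^ 9 ≠ 1 ∧
      orderOf ((σ, σ) : Equiv.Perm (CoreIdx 333) × Equiv.Perm (CoreIdx 333)) = 333 := by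
  obtain ⟨a', b', hab, ha1, hb1⟩ := legendrePair_normalise a b h
  have hcard : Fintype.card (CoreIdx 333) = 668 := by rw [card_coreIdx]
  refine ⟨twoCircCore a' b', (Equiv.sumCongr (Equiv.refl (Unit ⊕ Unit))
      (Equiv.sumCongr (Equiv.addRight (1 : ZMod 333)) (Equiv.addRight (1 : ZMod 333))) : Equiv.Perm (CoreIdx 333)), ⟨twoCircCore_pm a' b' hab.1 hab.2.1, ?_⟩, hcard, ?_, ?_, ?_, ?_, ?_⟩
  · rw [twoCircCore_mul_transpose a' b' hab ha1 hb1, hcard]; norm_num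
  · exact ⟨fun _ => Or.inl rfl, fun _ => Or.inl rfl, fun x y => by rw [twoCircCore_coreShift]; ring⟩
  · ext x
    obtain ⟨h1, h2, h3⟩ := coreShift_pow_apply (n := 333) 333
    rcases x with u | (i | i)
    · rw [h1]; rfl
    · rw [h2, Equiv.Perm.one_apply]
      rw [show ((333 : ℕ) : ZMod 333) = 0 from by decide, add_zero]
    · rw [h3, Equiv.Perm.one_apply]
      rw [show ((333 : ℕ) : ZMod 333) = 0 from by decide, add_zero]
  · intro h1
    have := congrArg (fun σ => σ (Sum.inr (Sum.inl 0))) h1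
    simp only [(coreShift_pow_apply (n := 333) 111).2.1, Equiv.Perm.one_apply, zero_add] at this
    exact absurd (Sum.inl.inj (Sum.inr.inj this)) (by decide)
  · intro h1
    have := congrArg (fun σ => σ (Sum.inr (Sum.inl 0))) h1
    simp only [(coreShift_pow_apply (n := 333) 9).2.1, Equiv.Perm.one_apply, zero_add] at this
    exact absurd (Sum.inl.inj (Sum.inr.inj this)) (by decide)
  · -- orderOf (σ, σ) = 333
    set x : Equiv.Perm (CoreIdx 333) × Equiv.Perm (CoreIdx 333) :=
      ((Equiv.sumCongr (Equiv.refl (Unit ⊕ Unit))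
      (Equiv.sumCongr (Equiv.addRight (1 : ZMod 333)) (Equiv.addRight (1 : ZMod 333))) : Equiv.Perm (CoreIdx 333)),
       (Equiv.sumCongr (Equiv.refl (Unit ⊕ Unit))
      (Equiv.sumCongr (Equiv.addRight (1 : ZMod 333)) (Equiv.addRight (1 : ZMod 333))) : Equiv.Perm (CoreIdx 333))) with hx
    have h333 : x ^ 333 = 1 := by
      rw [hx, Prod.pow_mk, Prod.mk_eq_one]
      obtain ⟨h1, h2, h3⟩ := coreShift_pow_apply (n := 333) 333
      have : (Equiv.sumCongr (Equiv.refl (Unit ⊕ Unit))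
      (Equiv.sumCongr (Equiv.addRight (1 : ZMod 333)) (Equiv.addRight (1 : ZMod 333))) : Equiv.Perm (CoreIdx 333)) ^ 333 = 1 := by
        ext y
        rcases y with u | (i | i)
        · rw [h1]; rfl
        · rw [h2, Equiv.Perm.one_apply, show ((333 : ℕ) : ZMod 333) = 0 from by decide, add_zero]
        · rw [h3, Equiv.Perm.one_apply, show ((333 : ℕ) : ZMod 333) = 0 from by decide, add_zero]
      exact ⟨this, this⟩
    have hne : ∀ m, 0 < m → m < 333 → x ^ m ≠ 1 := by
      intro m hm0 hm h1
      rw [hx, Prod.pow_mk, Prod.mk_eq_one] at h1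
      have := congrArg (fun σ => σ (Sum.inr (Sum.inl 0))) h1.1
      simp only [(coreShift_pow_apply (n := 333) m).2.1, Equiv.Perm.one_apply, zero_add] at this
      have hm' := Sum.inl.inj (Sum.inr.inj this)
      rw [ZMod.natCast_eq_zero_iff] at hm'
      exact absurd (Nat.le_of_dvd hm0 hm') (by omega)
    exact (orderOf_eq_iff (by norm_num)).mpr ⟨h333, fun m hm hm0 => hne m hm0 hm⟩

/-- **The dictionary, order 333.**  *Some Hadamard matrix of order `668` has a signed automorphism whose permutation pair
`(π, κ)` has order divisible by `333`* **iff** *a Legendre pair of length `333` exists.* -/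
theorem hadamard668_aut333_iff_legendrePair333 :
    (∃ (ι : Type) (_ : Fintype ι) (_ : DecidableEq ι) (H : Matrix ι ι ℤ) (π κ : Equiv.Perm ι) (d e : ι → ℤ),
        Fintype.card ι = 668 ∧ IsHadamardMatrix H ∧ IsSignedAut H π κ d e ∧
        333 ∣ orderOf ((π, κ) : Equiv.Perm ι × Equiv.Perm ι)) ↔
    ∃ a b : ZMod 333 → ℤ, LegendrePair a b := by
  constructor
  · rintro ⟨ι, _, _, H, π, κ, d, e, hι, hH, haut, hdvd⟩
    exact legendrePair_of_hadamard668_orderOf_dvd_333 hH hι haut hdvd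
  · rintro ⟨a, b, h⟩
    obtain ⟨H, σ, hH, hcard, haut, -, -, -, hord⟩ := hadamard668_aut333_of_legendrePair a b h
    exact ⟨CoreIdx 333, inferInstance, inferInstance, H, σ, σ, _, _, hcard, hH, haut, by rw [hord]⟩

end Summit.Ventures.DiscreteObjects.Hadamard
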